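import Literature.Computability.ImplicitComplexity.STAWeighted
import HarnessLib

/-!
# Renaming of term variables and admissible weakening in `STA` derivations

Support file for the `PTIME` soundness half of `STACapturesP` (GMR08 Thm. 3.5). Two structural
properties of `STA` derivations that [GR07]/[GMR08] use silently ("`x` fresh", "renaming the
variables of the copies of a box apart", "followed by rules `(w)` and `(m)` working on variables
not occurring in `M`", Property 1) and that must be spelled out in de Bruijn form:

* `MTyping.rename_ctx` — **renaming lemma**: if `Γ ⊢ M : σ` and `ρ` is injective on the support
  of `Γ`, then `Γ∘ρ⁻¹ ⊢ M[ρ] : σ` (`Ctx.image Γ ρ`), with the same rank bound, degree and weight.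
  Corollary `MTyping.shift_succ`: `Γ ⊢ M : σ ⟹ (·, Γ) ⊢ M[succ] : σ` (carrying an argument under
  a binder).
* `MTyping.extend` — **admissible weakening**: a derivable judgement stays derivable, with the
  same measures, in any finite extension of its context (linear assumptions by `(w)`, modal ones
  by a rank-`0` multiplexor `(m)`; GMR08 §2: "The weakening rule is a particular case of
  multiplexor, with `n = 0`").

## References

* [GaboardiMarionRonchidellarocca2008] GMR08, Table 2 (rules `(w)`, `(m)`), §2, Property 1.
* [GaboardiRonchiDellaRocca2007] GR07, §3–4.
-/

namespace Literature.Computability.ImplicitComplexity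

namespace STA

/-! ### Injective renamings and image contexts -/

namespace Ctx

/-- `ρ` is injective on the support of `Γ`. [folklore] -/
def InjOn (Γ : Ctx) (ρ : ℕ → ℕ) : Prop :=
  ∀ i₁ i₂, Γ i₁ ≠ none → Γ i₂ ≠ none → ρ i₁ = ρ i₂ → i₁ = i₂

/-- Injectivity on a support passes to smaller supports. [folklore] -/
theorem InjOn.of_subset {Γ Γ' : Ctx} {ρ : ℕ → ℕ} (h : Γ.InjOn ρ)
    (hsub : ∀ i, Γ' i ≠ none → Γ i ≠ none) : Γ'.InjOn ρ :=
  fun i₁ i₂ h₁ h₂ he => h i₁ i₂ (hsub _ h₁) (hsub _ h₂) he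

/-- The image context `Γ∘ρ⁻¹`: slot `ρ i` receives the assumption of slot `i` (for `ρ` injective
on the support of `Γ`); slots outside the image are empty. [folklore] -/
noncomputable def image (Γ : Ctx) (ρ : ℕ → ℕ) : Ctx := fun i' =>
  by classical exact if h : ∃ i, Γ i ≠ none ∧ ρ i = i' then Γ (Classical.choose h) else none

/-- Slots outside the image are empty. [folklore] -/
theorem image_eq_none {Γ : Ctx} {ρ : ℕ → ℕ} {i' : ℕ} (h : ∀ i, Γ i ≠ none → ρ i ≠ i') :
    Γ.image ρ i' = none := by
  classical
  unfold image
  rw [dif_neg]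
  rintro ⟨i, hi, he⟩
  exact h i hi he

/-- The image of slot `i` carries the assumption of slot `i`. [folklore] -/
theorem image_apply {Γ : Ctx} {ρ : ℕ → ℕ} (hρ : Γ.InjOn ρ) {i : ℕ} (hi : Γ i ≠ none) :
    Γ.image ρ (ρ i) = Γ i := by
  classical
  unfold image
  have h : ∃ i₀, Γ i₀ ≠ none ∧ ρ i₀ = ρ i := ⟨i, hi, rfl⟩
  rw [dif_pos h]
  have h1 := Classical.choose_spec h
  rw [hρ _ _ h1.1 hi h1.2]

/-- Nonempty slots of the image have a preimage. [folklore] -/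
theorem exists_of_image_ne_none {Γ : Ctx} {ρ : ℕ → ℕ} {i' : ℕ} (h : Γ.image ρ i' ≠ none) :
    ∃ i, Γ i ≠ none ∧ ρ i = i' := by
  by_contra hne
  exact h (image_eq_none fun i hi he => hne ⟨i, hi, he⟩)

/-- **Extensionality for image contexts**: `Γ.image ρ = Γ'` as soon as `Γ'` carries `Γ i` at
every `ρ i` of the support and is empty off the image. [folklore] -/
theorem image_eq_of {Γ Γ' : Ctx} {ρ : ℕ → ℕ} (hρ : Γ.InjOn ρ)
    (h₁ : ∀ i, Γ i ≠ none → Γ' (ρ i) = Γ i)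
    (h₂ : ∀ i', Γ' i' ≠ none → ∃ i, Γ i ≠ none ∧ ρ i = i') : Γ.image ρ = Γ' := by
  funext i'
  by_cases h : ∃ i, Γ i ≠ none ∧ ρ i = i'
  · obtain ⟨i, hi, rfl⟩ := h
    rw [image_apply hρ hi, h₁ i hi]
  · rw [image_eq_none fun i hi he => h ⟨i, hi, he⟩]
    by_contra hne
    exact h (h₂ i' (Ne.symm hne))

/-- The support of the image is bounded when the support of `Γ` is. [folklore] -/
theorem image_boundedBy {Γ : Ctx} {n : ℕ} (hb : Γ.BoundedBy n) (ρ : ℕ → ℕ) :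
    (Γ.image ρ).BoundedBy ((Finset.range n).sup ρ + 1) := by
  intro i' hi'
  refine image_eq_none fun i hi he => ?_
  have hin : i < n := by
    by_contra hn
    exact hi (hb i (by omega))
  have : ρ i ≤ (Finset.range n).sup ρ := Finset.le_sup (f := ρ) (Finset.mem_range.2 hin)
  omega

/-- Mapping the assumptions commutes with taking images. [folklore] -/
theorem image_map {Γ : Ctx} {ρ : ℕ → ℕ} (hρ : Γ.InjOn ρ) (f : SoftTy → SoftTy) :
    Ctx.image (fun i => (Γ i).map f) ρ = fun i' => (Γ.image ρ i').map f := by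
  have hρ' : Ctx.InjOn (fun i => (Γ i).map f) ρ :=
    hρ.of_subset fun i hi => by
      intro h0
      apply hi
      simp [h0]
  refine image_eq_of hρ' (fun i hi => ?_) (fun i' hi' => ?_)
  · have hi0 : Γ i ≠ none := by
      intro h0
      apply hi
      simp [h0]
    simp [image_apply hρ hi0]
  · have h0 : Γ.image ρ i' ≠ none := by
      intro h0
      apply hi'
      simp [h0]
    obtain ⟨i, hi, he⟩ := exists_of_image_ne_none h0
    exact ⟨i, by simp [Option.map_eq_none_iff, hi], he⟩

end Ctx

/-! ### The renaming lemma -/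

namespace MTyping

variable {r d w : ℕ} {Γ : Ctx} {M : Term} {σ : SoftTy}

/-- **Renaming lemma** for weighted `STA` derivations: an injective-on-support renaming of the
term variables transports a derivation of `Γ ⊢ M : σ` to one of `Γ∘ρ⁻¹ ⊢ M[ρ] : σ` with the same
rank bound, degree and weight (multiplexed variables are renamed apart into fresh slots, which
exist because contexts are finite). [cite: GaboardiMarionRonchidellarocca2008, Table 2] -/
theorem rename_ctx (h : MTyping r w d Γ M σ) {ρ : ℕ → ℕ} (hρ : Γ.InjOn ρ) :
    MTyping r w d (Γ.image ρ) (M.rename ρ) σ := by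
  induction h generalizing ρ with
  | @ax Γ i₀ A hs =>
    refine MTyping.ax ⟨?_, fun j hj => ?_⟩
    · rw [Ctx.image_apply hρ (by rw [hs.1]; simp), hs.1]
    · refine Ctx.image_eq_none fun i hi he => ?_
      have : i = i₀ := by
        by_contra hne
        exact hi (hs.2 i hne)
      subst this
      exact hj he.symm
  | @weak d w Γ₀ Γ M τ j A h₀ hj hΓ ih =>
    have hsub : ∀ i, Γ₀ i ≠ none → Γ i ≠ none := by
      intro i hi
      rw [hΓ]
      by_cases hij : i = j
      · subst hij; exact absurd hj hi
      · rwa [Function.update_of_ne hij]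
    have hΓj : Γ j = some ⟨0, A⟩ := by rw [hΓ]; simp
    have hρ₀ : Γ₀.InjOn ρ := hρ.of_subset hsub
    have hfresh : Γ₀.image ρ (ρ j) = none := by
      refine Ctx.image_eq_none fun i hi he => ?_
      have := hρ i j (hsub i hi) (by rw [hΓj]; simp) he
      subst this
      exact hi hj
    refine MTyping.weak (ρ j) A (ih hρ₀) hfresh ?_
    refine Ctx.image_eq_of hρ (fun i hi => ?_) (fun i' hi' => ?_)
    · by_cases hij : i = j
      · subst hij
        simp [hΓj]
      · have hi0 : Γ₀ i ≠ none := by rwa [hΓ, Function.update_of_ne hij] at hi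
        have hne : ρ i ≠ ρ j := fun he => hij (hρ i j hi (by rw [hΓj]; simp) he)
        rw [Function.update_of_ne hne, Ctx.image_apply hρ₀ hi0, hΓ, Function.update_of_ne hij]
    · by_cases he : i' = ρ j
      · exact ⟨j, by rw [hΓj]; simp, he.symm⟩
      · rw [Function.update_of_ne he] at hi'
        obtain ⟨i, hi, hie⟩ := Ctx.exists_of_image_ne_none hi'
        exact ⟨i, hsub i hi, hie⟩
  | @lam d w Γ M k B A h₀ ih =>
    have hρ' : (Ctx.cons (some ⟨k, B⟩) Γ).InjOn (liftRen ρ) := by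
      intro i₁ i₂ h₁ h₂ he
      cases i₁ with
      | zero =>
        cases i₂ with
        | zero => rfl
        | succ i₂ => simp at he
      | succ i₁ =>
        cases i₂ with
        | zero => simp at he
        | succ i₂ =>
          simp only [liftRen_succ, Nat.add_right_cancel_iff] at he
          rw [hρ i₁ i₂ h₁ h₂ he]
    have himg : (Ctx.cons (some ⟨k, B⟩) Γ).image (liftRen ρ) = Ctx.cons (some ⟨k, B⟩) (Γ.image ρ) := by
      refine Ctx.image_eq_of hρ' (fun i hi => ?_) (fun i' hi' => ?_)
      · cases i with
        | zero => rfl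
        | succ i => exact Ctx.image_apply hρ hi
      · cases i' with
        | zero => exact ⟨0, by simp [Ctx.cons], rfl⟩
        | succ i' =>
          obtain ⟨i, hi, he⟩ := Ctx.exists_of_image_ne_none (Γ := Γ) hi'
          exact ⟨i + 1, hi, by simp [he]⟩
    have := ih hρ'
    rw [himg] at this
    exact MTyping.lam this
  | @app d₁ d₂ w₁ w₂ Γ Γ₁ Γ₂ M N k B A hs h₁ h₂ ih₁ ih₂ =>
    have hsub₁ : ∀ i, Γ₁ i ≠ none → Γ i ≠ none := fun i hi => by
      rcases hs i with ⟨e, -⟩ | ⟨e, -⟩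
      · rwa [← e]
      · exact absurd e hi
    have hsub₂ : ∀ i, Γ₂ i ≠ none → Γ i ≠ none := fun i hi => by
      rcases hs i with ⟨-, e⟩ | ⟨-, e⟩
      · exact absurd e hi
      · rwa [← e]
    have hρ₁ := hρ.of_subset hsub₁
    have hρ₂ := hρ.of_subset hsub₂
    refine MTyping.app (fun i' => ?_) (ih₁ hρ₁) (ih₂ hρ₂)
    by_cases hi' : ∃ i, Γ i ≠ none ∧ ρ i = i'
    · obtain ⟨i, hi, rfl⟩ := hi'
      rw [Ctx.image_apply hρ hi]
      rcases hs i with ⟨e₁, e₂⟩ | ⟨e₁, e₂⟩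
      · refine Or.inl ⟨?_, Ctx.image_eq_none fun i₂ hi₂ he => ?_⟩
        · rw [Ctx.image_apply hρ₁ (by rwa [e₁]), e₁]
        · have := hρ i₂ i (hsub₂ _ hi₂) hi he
          subst this
          exact hi₂ e₂
      · refine Or.inr ⟨Ctx.image_eq_none fun i₁ hi₁ he => ?_, ?_⟩
        · have := hρ i₁ i (hsub₁ _ hi₁) hi he
          subst this
          exact hi₁ e₁
        · rw [Ctx.image_apply hρ₂ (by rwa [e₂]), e₂]
    · have h0 : ∀ i, Γ i ≠ none → ρ i ≠ i' := fun i hi he => hi' ⟨i, hi, he⟩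
      refine Or.inl ⟨?_, ?_⟩
      · rw [Ctx.image_eq_none h0, Ctx.image_eq_none fun i hi => h0 i (hsub₁ i hi)]
      · exact Ctx.image_eq_none fun i hi => h0 i (hsub₂ i hi)
  | @mpx d w Γ₀ Γ M₀ M μ σ S j h₀ hS hj hr hΓ hM ih =>
    -- supports
    obtain ⟨n₀, hn₀⟩ := h₀.exists_boundedBy
    have hjS : j ∉ S := fun hjS => by rw [hS j hjS] at hj; exact Option.some_ne_none _ hj
    have hΓj : Γ j = some σ.bang := by rw [hΓ]; simp [Ctx.mpx, hjS]
    have hΓS : ∀ i ∈ S, Γ i = none := fun i hi => by rw [hΓ]; simp [Ctx.mpx, hi]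
    have hΓof : ∀ i, i ∉ S → i ≠ j → Γ i = Γ₀ i := fun i hi hij => by
      rw [hΓ]; simp [Ctx.mpx, hi, hij]
    -- a bound `N` beyond every `ρ`-image of the support of `Γ`
    set n := max n₀ (j + 1) with hn
    have hbΓ : Γ.BoundedBy n := by
      intro i hi
      rw [hΓ]
      simp only [Ctx.mpx]
      split_ifs with h1 h2
      · rfl
      · omega
      · exact hn₀ i (le_of_max_le_left hi)
    set N := (Finset.range n).sup ρ + 1 with hN
    have hlt : ∀ i, Γ i ≠ none → ρ i < N := by
      intro i hi
      have hin : i < n := by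
        by_contra hc
        exact hi (hbΓ i (by omega))
      have : ρ i ≤ (Finset.range n).sup ρ := Finset.le_sup (f := ρ) (Finset.mem_range.2 hin)
      omega
    -- the renaming of the premise: contracted slots go to fresh slots `N + i`
    obtain ⟨ρ₀, hρ₀S, hρ₀of⟩ : ∃ ρ₀ : ℕ → ℕ, (∀ i ∈ S, ρ₀ i = N + i) ∧ ∀ i, i ∉ S → ρ₀ i = ρ i :=
      ⟨fun i => if i ∈ S then N + i else ρ i, fun i hi => by simp [hi], fun i hi => by simp [hi]⟩
    have hsupp₀ : ∀ i, Γ₀ i ≠ none → i ∉ S → Γ i ≠ none ∧ i ≠ j := by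
      intro i hi hiS
      have hij : i ≠ j := fun h => by subst h; exact hi hj
      exact ⟨by rwa [hΓof i hiS hij], hij⟩
    have hρ₀inj : Γ₀.InjOn ρ₀ := by
      intro i₁ i₂ h₁ h₂ he
      by_cases hi₁ : i₁ ∈ S <;> by_cases hi₂ : i₂ ∈ S
      · rw [hρ₀S _ hi₁, hρ₀S _ hi₂] at he; omega
      · rw [hρ₀S _ hi₁, hρ₀of _ hi₂] at he
        have := hlt i₂ (hsupp₀ i₂ h₂ hi₂).1
        omega
      · rw [hρ₀of _ hi₁, hρ₀S _ hi₂] at he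
        have := hlt i₁ (hsupp₀ i₁ h₁ hi₁).1
        omega
      · rw [hρ₀of _ hi₁, hρ₀of _ hi₂] at he
        exact hρ i₁ i₂ (hsupp₀ i₁ h₁ hi₁).1 (hsupp₀ i₂ h₂ hi₂).1 he
    have hder := ih hρ₀inj
    -- the new multiplexor: `S' = N + S` into `ρ j`
    have hinjN : Function.Injective (fun i : ℕ => N + i) := fun a b h => by simpa using h
    refine MTyping.mpx (σ := σ) (S.image fun i => N + i) (ρ j) hder ?_ ?_ ?_ ?_ ?_
    · intro i' hi'
      obtain ⟨i, hi, rfl⟩ := Finset.mem_image.1 hi'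
      have := Ctx.image_apply hρ₀inj (i := i) (by rw [hS i hi]; simp)
      rw [hρ₀S i hi] at this
      rw [this, hS i hi]
    · refine Ctx.image_eq_none fun i hi he => ?_
      by_cases hiS : i ∈ S
      · rw [hρ₀S i hiS] at he
        have := hlt j (by rw [hΓj]; simp)
        omega
      · rw [hρ₀of i hiS] at he
        obtain ⟨hΓi, hij⟩ := hsupp₀ i hi hiS
        exact hij (hρ i j hΓi (by rw [hΓj]; simp) he)
    · rw [Finset.card_image_of_injective _ hinjN]; exact hr
    · refine Ctx.image_eq_of hρ (fun i hi => ?_) (fun i' hi' => ?_)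
      · have hiS : i ∉ S := fun hiS => hi (hΓS i hiS)
        have hnot : ρ i ∉ S.image fun i => N + i := by
          intro hm
          obtain ⟨i₂, -, he⟩ := Finset.mem_image.1 hm
          have := hlt i hi
          omega
        by_cases hij : i = j
        · subst hij
          simp [Ctx.mpx, hnot, hΓj]
        · have hΓ₀i : Γ₀ i ≠ none := by rwa [hΓof i hiS hij] at hi
          have hne : ρ i ≠ ρ j := fun he => hij (hρ i j hi (by rw [hΓj]; simp) he)
          simp only [Ctx.mpx, hnot, if_false, hne]
          rw [← hρ₀of i hiS, Ctx.image_apply hρ₀inj hΓ₀i, hΓof i hiS hij]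
      · simp only [Ctx.mpx] at hi'
        split_ifs at hi' with h1 h2
        · exact absurd rfl hi'
        · exact ⟨j, by rw [hΓj]; simp, h2.symm⟩
        · obtain ⟨i, hi, he⟩ := Ctx.exists_of_image_ne_none hi'
          by_cases hiS : i ∈ S
          · rw [hρ₀S i hiS] at he
            exact absurd (Finset.mem_image.2 ⟨i, hiS, he⟩) h1
          · rw [hρ₀of i hiS] at he
            exact ⟨i, (hsupp₀ i hi hiS).1, he⟩
    · rw [hM, Term.rename_rename, Term.rename_rename]
      refine Term.rename_congr_freeIn M₀ fun i hi => ?_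
      have hΓ₀i : Γ₀ i ≠ none := h₀.isSome_of_freeIn hi
      show ρ (mpxRen S j i) = mpxRen (S.image fun i => N + i) (ρ j) (ρ₀ i)
      by_cases hiS : i ∈ S
      · have hm : ρ₀ i ∈ S.image fun i => N + i := Finset.mem_image.2 ⟨i, hiS, (hρ₀S i hiS).symm⟩
        simp only [mpxRen, if_pos hm, if_pos hiS]
      · have hnot : ρ₀ i ∉ S.image fun i => N + i := by
          intro hm
          obtain ⟨i₂, -, he⟩ := Finset.mem_image.1 hm
          rw [hρ₀of i hiS] at he
          have := hlt i (hsupp₀ i hΓ₀i hiS).1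
          omega
        rw [hρ₀of i hiS] at hnot
        simp only [mpxRen, if_neg hiS, hρ₀of i hiS, if_neg hnot]
  | @sp d w Γ₀ Γ M k A h₀ hΓ ih =>
    have hsub : ∀ i, Γ₀ i ≠ none ↔ Γ i ≠ none := fun i => by rw [hΓ]; simp [Ctx.bang]
    have hρ₀ : Γ₀.InjOn ρ := hρ.of_subset fun i hi => (hsub i).1 hi
    refine MTyping.sp (ih hρ₀) ?_
    rw [hΓ]
    exact Ctx.image_map hρ₀ SoftTy.bang
  | @allI d w Γ Δ M A h₀ hΔ ih =>
    have hsub : ∀ i, Δ i ≠ none ↔ Γ i ≠ none := fun i => by rw [hΔ]; simp [Ctx.shift]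
    have hρΔ : Δ.InjOn ρ := hρ.of_subset fun i hi => (hsub i).1 hi
    refine MTyping.allI (ih hρΔ) ?_
    rw [hΔ]
    exact Ctx.image_map hρ SoftTy.shift
  | allE A _ ih => exact MTyping.allE A (ih hρ)

/-- **Carrying a term under a binder**: `Γ ⊢ M : σ ⟹ (·, Γ) ⊢ M[succ] : σ`, same measures.
[folklore] -/
theorem shift_succ (h : MTyping r w d Γ M σ) :
    MTyping r w d (Ctx.cons none Γ) (M.rename Nat.succ) σ := by
  have hρ : Γ.InjOn Nat.succ := fun i₁ i₂ _ _ he => Nat.succ_injective he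
  have := h.rename_ctx hρ
  have himg : Γ.image Nat.succ = Ctx.cons none Γ :=
    Ctx.image_eq_of hρ (fun i _ => rfl) (fun i' hi' => by
      cases i' with
      | zero => exact absurd rfl hi'
      | succ i => exact ⟨i, hi', rfl⟩)
  rwa [himg] at this

/-! ### Admissible weakening -/

/-- One admissible weakening step: add an arbitrary assumption at an empty slot (a linear one by
`(w)`, a modal one by a rank-`0` multiplexor). [cite: GaboardiMarionRonchidellarocca2008, §2 and Table 2] -/
theorem weaken_one (h : MTyping r w d Γ M σ) {j : ℕ} (hj : Γ j = none) (τ : SoftTy) :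
    MTyping r w d (Function.update Γ j (some τ)) M σ := by
  obtain ⟨k, A⟩ := τ
  cases k with
  | zero => exact MTyping.weak j A h hj rfl
  | succ k =>
    refine MTyping.mpx (σ := ⟨k, A⟩) ∅ j h (by simp) hj (by simp) ?_ ?_
    · funext i
      by_cases hij : i = j
      · subst hij; simp [Ctx.mpx, SoftTy.bang]
      · simp [Ctx.mpx, hij]
    · symm
      exact Term.rename_eq_self_of_freeIn M fun i _ => by simp [mpxRen]

/-- **Admissible weakening**: if `Γ ⊢ M : σ` then `Γ' ⊢ M : σ` with the same measures for every
finitely supported `Γ'` extending `Γ` (same assumption at every slot of the support of `Γ`).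
[cite: GaboardiMarionRonchidellarocca2008, §2 ("weakening is a particular case of multiplexor") and Table 2 (w)] -/
theorem extend (h : MTyping r w d Γ M σ) {Γ' : Ctx} (hle : ∀ i, Γ i ≠ none → Γ' i = Γ i)
    {n : ℕ} (hb : Γ'.BoundedBy n) : MTyping r w d Γ' M σ := by
  -- `Γₘ` agrees with `Γ'` below `m` and with `Γ` from `m` on
  have key : ∀ m, MTyping r w d (fun i => if i < m then Γ' i else Γ i) M σ := by
    intro m
    induction m with
    | zero => simpa using h
    | succ m ih =>
      by_cases hΓm : Γ m = none
      · cases hΓ'm : Γ' m with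
        | none =>
          have hctx : (fun i => if i < m + 1 then Γ' i else Γ i) =
              fun i => if i < m then Γ' i else Γ i := by
            funext i
            by_cases h1 : i = m
            · subst h1; simp [hΓm, hΓ'm]
            · have : i < m + 1 ↔ i < m := by omega
              simp [this]
          rw [hctx]
          exact ih
        | some τ =>
          have hm : (fun i => if i < m then Γ' i else Γ i) m = none := by simp [hΓm]
          have hctx : (fun i => if i < m + 1 then Γ' i else Γ i) =
              Function.update (fun i => if i < m then Γ' i else Γ i) m (some τ) := by
            funext i
            by_cases h1 : i = m
            · subst h1; simp [hΓ'm]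
            · have : i < m + 1 ↔ i < m := by omega
              simp [Function.update_of_ne h1, this]
          rw [hctx]
          exact weaken_one ih hm τ
      · have heq : Γ' m = Γ m := hle m hΓm
        have hctx : (fun i => if i < m + 1 then Γ' i else Γ i) =
            fun i => if i < m then Γ' i else Γ i := by
          funext i
          by_cases h1 : i = m
          · subst h1; simp [heq]
          · have : i < m + 1 ↔ i < m := by omega
            simp [this]
        rw [hctx]
        exact ih
  have hctx : Γ' = fun i => if i < n then Γ' i else Γ i := by
    funext i
    by_cases hi : i < n
    · simp [hi]
    · simp only [hi, if_false]
      have h' : Γ' i = none := hb i (by omega)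
      rcases hΓi : Γ i with _ | τ
      · exact h'
      · exfalso
        have := hle i (by rw [hΓi]; simp)
        rw [h', hΓi] at this
        cases this
  rw [hctx]
  exact key n

end MTyping

end STA

end Literature.Computability.ImplicitComplexity
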